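import Literature.NumberTheory.EllipticCurves.IsogenyComplexUniformizationProofs
import Literature.NumberTheory.EllipticCurves.IsogenyRealPeriodProofs
import Literature.NumberTheory.EllipticCurves.IsogenyMultiplierDegreeProofs
import Literature.NumberTheory.EllipticCurves.NeronIsogenyScalingHoldsProofs
import Literature.NumberTheory.EllipticCurves.ModularCurveNeronLatticeProofs
import HarnessLib

/-!
# The Néron scalar of a `ℚ`-isogeny on prescribed Néron period pairs, with index = degree

For a `ℚ`-isogeny `φ : W → W₂` between GLOBALLY MINIMAL Weierstrass models and Néron period pairs `L`, `L₂`
(`IsNeronLatticeOf (W.baseChange ℂ) L`, `IsNeronLatticeOf (W₂.baseChange ℂ) L₂`) there is an INTEGER `n` with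
`n · Λ_W ⊆ Λ_{W₂}` and `[Λ_{W₂} : n · Λ_W] = deg φ`.

Proof (assembled from tree theorems only): the analytic representation `φ_ℂ(u₁ z) = u₂(α z)` with
`α Λ_W ⊆ Λ_{W₂}` and `#ker φ_ℂ = [Λ_{W₂} : α Λ_W]` (`Isogeny.exists_mul_baseChange_apply_eq`, Silverman *AEC*
Thm. VI.4.1(b)); `α ∈ ℚ` (`Isogeny.exists_algebraMap_eq_of_baseChange_apply_eq`, Galois descent of the multiplier);
`α ∈ ℤ` by the integral Néron scaling of globally minimal models (`integral_neronScaling_of_isGloballyMinimal_holds`,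
Silverman *ATAEC* IV.5.1 / IV.6.1 / Cor. IV.9.1); `#ker φ_ℂ = deg φ` (`Isogeny.natCard_ker_baseChange_eq_degree`).

Provenance: this is the route-independent §2 of
`Summits/BirchSwinnertonDyer/BirchSwinnertonDyer/Theorems/TameQuarticManinParityNeronUnitForcesKodairaThree.lean`
(`TameQuarticManinParity.exists_neronScaling_relIndex_eq_degree`, seat bsd-line-ttd-p1 g9), RE-HOMED into Literature at
the request of the C2/C3 LEAD of route `ManinLocalTwoThree` (T-p1-g8-1, 2026-08-28T18:28:57Z): users outside route
`TameQuarticManinParity` can now import this statement without pulling that route's `Theses` file into their cone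
(`lint.theses-cone`).  Statement and proof VERBATIM; the Theorems copy can be re-pointed to this one by its owner route.
Theorem only; no definition, no named fact.  BSD is not proved by this; Manin `c = 1` is not proved by this.
-/

set_option autoImplicit false

noncomputable section

open scoped Classical

namespace WeierstrassCurve

open PeriodPair Literature.NumberTheory.EllipticCurves Literature.NumberTheory.EllipticCurves.ModularForms

/-- **The Néron scalar of a `ℚ`-isogeny between globally minimal curves, on prescribed Néron period
pairs, with its index**: for `φ : W → W₂` and Néron period pairs `L, L₂` there is `n ∈ ℤ` with
`nΛ_W ⊆ Λ_{W₂}` and `[Λ_{W₂} : nΛ_W] = deg φ` (Silverman VI.4.1(b): `φ_ℂ(u z) = u₂(n z)`,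
`#ker φ_ℂ = [Λ₂ : nΛ]`; `n ∈ ℚ` by Galois, `n ∈ ℤ` by the integral Néron scaling).  Re-homed VERBATIM from
`Theorems.TameQuarticManinParity.exists_neronScaling_relIndex_eq_degree` (route-independent content).
[cite: SilvermanAEC2009, Thm. VI.4.1(b)] [cite: SilvermanATAEC1994, IV.5.1 with IV.6.1 and Cor. IV.9.1] -/
theorem Isogeny.exists_int_neronScaling_relIndex_eq_degree {W W₂ : WeierstrassCurve ℚ} [W.IsElliptic]
    [W₂.IsElliptic] [W.IsGloballyMinimal] [W₂.IsGloballyMinimal] (φ : Isogeny W W₂)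
    {L L₂ : PeriodPair} (hL : IsNeronLatticeOf (W.baseChange ℂ) L)
    (hL₂ : IsNeronLatticeOf (W₂.baseChange ℂ) L₂) :
    ∃ n : ℤ, (∀ z ∈ L.lattice, (n : ℂ) * z ∈ L₂.lattice) ∧
      (L.lattice.toAddSubgroup.map (AddMonoidHom.mulLeft (n : ℂ))).relIndex L₂.lattice.toAddSubgroup =
        φ.degree := by
  haveI : Algebra.IsAlgebraic ℚ (AlgebraicClosure ℚ) := AlgebraicClosure.isAlgebraic ℚ
  letI : Algebra (AlgebraicClosure ℚ) ℂ :=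
    (IsAlgClosed.lift : AlgebraicClosure ℚ →ₐ[ℚ] ℂ).toRingHom.toAlgebra
  haveI : IsScalarTower ℚ (AlgebraicClosure ℚ) ℂ :=
    IsScalarTower.of_algebraMap_eq' (Subsingleton.elim _ _)
  obtain ⟨u₁, hker₁, -, hu₁⟩ := L.exists_addMonoidHom_of_g₂_g₃' hL.1 hL.2
  obtain ⟨u₂, hker₂, -, hu₂⟩ := L₂.exists_addMonoidHom_of_g₂_g₃' hL₂.1 hL₂.2
  obtain ⟨α, hα0, hαΛ, happ, hcard⟩ :=
    φ.exists_mul_baseChange_apply_eq hL.1 hL.2 hL₂.1 hL₂.2 u₁ hker₁ hu₁ u₂ hker₂ hu₂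
  obtain ⟨k, hk⟩ := φ.exists_algebraMap_eq_of_baseChange_apply_eq hL.1 hL.2 hL₂.1 hL₂.2 u₁ hker₁ hu₁
    u₂ hker₂ hu₂ happ
  have hkC : (k : ℂ) = α := by rw [← hk, eq_ratCast]
  have hle : ∀ z ∈ L.lattice, (k : ℂ) * z ∈ L₂.lattice := fun z hz ↦ by rw [hkC]; exact hαΛ z hz
  obtain ⟨n, hn⟩ := integral_neronScaling_of_isGloballyMinimal_holds W W₂ L L₂ hL hL₂ k hle
  have hnC : (n : ℂ) = α := by rw [← hkC, ← hn]; push_cast; rfl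
  refine ⟨n, fun z hz ↦ by rw [hnC]; exact hαΛ z hz, ?_⟩
  have hsub : L.lattice.toAddSubgroup.map (AddMonoidHom.mulLeft (n : ℂ)) =
      (L.mulLeft α hα0).lattice.toAddSubgroup := by
    ext z
    simp only [Submodule.mem_toAddSubgroup, PeriodPair.mem_mulLeft_lattice, AddSubgroup.mem_map,
      AddMonoidHom.coe_mulLeft, hnC]
    constructor
    · rintro ⟨y, hy, rfl⟩
      rwa [inv_mul_cancel_left₀ hα0]
    · intro hz
      exact ⟨_, hz, by rw [mul_inv_cancel_left₀ hα0]⟩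
  rw [hsub, ← hcard, Isogeny.natCard_ker_baseChange_eq_degree]

end WeierstrassCurve

end
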